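import Mathlib
import HarnessLib
import Summits.HubbardSuperconductivity.HubbardSuperconductivity.Theorems.KLProgrammeKLRegimeFatFrameInstance
import Summits.HubbardSuperconductivity.HubbardSuperconductivity.Theorems.KLProgrammeH10TwoPointLimitOverlapKernelCharSum
import Summits.HubbardSuperconductivity.HubbardSuperconductivity.Theorems.KLProgrammeH10TwoPointLimitFrameTorusBridge

/-!
# Route `KLProgramme` — engine support, route (L2): the THIN × FAT pair of BGM (2.71a) reduces to THIN × THIN pairs

Cell `gate-hubbard-kl`, seat p4 (C5a lead), g7.  The single-scale step `hubbardSectorKernelNorm_effAction_le_of_sectorNorm` at scale `n`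
consumes, besides the propagator constant `α` (hrow/hcol), the row and column sums `hrow′/hcol′` of the overlap kernel
`sectorAnalysisMatrix β F′ * sectorSubMatrix β Ft` of the NEW thin family `F′ = klAnisoFamily … n₁` against the FAT family
`Ft = bgmFatMultiplier … n₂` of the old scale (`n₂ + 1 ≤ n₁`; the engine: `n₁ = n`, `n₂ = n − 1`).  KEY REDUCTION (this file):
on the support of `C_{-n₁}⁻¹` both plateaux `C_{-n₂+1}⁻¹` and `C_{-n₂}⁻¹` are `≡ 1` (`gnScaleCutoff_eq_one`, the argument of
`bgmFatMultiplier_mul_bgmMultiplier`), so POINTWISE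

  `klAniso n₁ ω₁ k · bgmFat n₂ ω₂ k = Σ_{a ∈ S_{ω₂}} klAniso n₁ ω₁ k · klAniso n₂ a k`   (**`klAnisoFamily_mul_bgmFatMultiplier_eq_sum`**),

`S_ω` the (`≤ 3`-element, `card_fatNbr_le_three`) neighbour set.  Hence the space-time character sum of the thin × fat symbol is at most
the sum of at most three thin × thin character sums (**`charSum_klAniso_bgmFat_le`**), the overlap counts of the thin × fat pair are
`≤ 27` (coarse side, **`card_overlap_klAniso_bgmFat_coarse_le`**) and `≤ 27·2^{n₁−n₂}` (fine side, **`card_overlap_klAniso_bgmFat_fine_le`**),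
and `hrow′ ≤ 81·T/(βL²)`, `hcol′ ≤ 81·2^{n₁−n₂}·T/(βL²)` follow from ANY uniform bound `T` on the thin × thin character sums
(**`overlap_rowSum_klAniso_bgmFat_le`**, **`overlap_colSum_klAniso_bgmFat_le`**) — `T` is supplied by the p4 symbol layer
(`charSum_klAnisoPair_le`, `…SectorMultiplierL1`, and its uniform packaging `…SectorMultiplierBound`).
Everything is proved; no definitions, no named facts. [cite: BenfattoGiulianiMastropietro2006, §2.7 (2.66), (2.71)–(2.71a)]
-/

noncomputable section

namespace Summit.HubbardSuperconductivity.HubbardSuperconductivity.Theorems.TorusFourierL2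

set_option linter.dupNamespace false -- summit = problem name (single-conjunct summit), D-0017

open Finset Literature.MathematicalPhysics.QuantumLattice Literature.Probability.LatticeModels
open Summit.HubbardSuperconductivity.HubbardSuperconductivity.Theorems.KLProgrammeLegKernels
open Summit.HubbardSuperconductivity.HubbardSuperconductivity.Theorems.PerturbedFermiCurve
open scoped Real

open Classical

variable {L M : ℕ} [NeZero L]

/-! ### §1 The pointwise reduction -/

omit [NeZero L] in
/-- **Thin × fat = Σ thin × thin, pointwise.**  For `n₂ + 1 ≤ n₁`, every `ω₁, ω₂` and every frequency–momentum `k`: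
`klAniso n₁ ω₁ k · F̃_{n₂,ω₂}(k) = Σ_{a ∈ S_{ω₂}} klAniso n₁ ω₁ k · klAniso n₂ a k` — on the support of `C_{-n₁}⁻¹` the fat radial plateau
`C_{-n₂+1}⁻¹` and the thin cutoff `C_{-n₂}⁻¹` are both `1`. [cite: BenfattoGiulianiMastropietro2006, §2.7 (2.66)] -/
theorem klAnisoFamily_mul_bgmFatMultiplier_eq_sum {e₀ : ℝ} (he : 0 < e₀) (β μ : ℝ) (K : TrigPolyC4v) {n₁ n₂ : ℕ}
    (hn : n₂ + 1 ≤ n₁) (ω₁ : Fin (sectorCount n₁)) (ω₂ : Fin (sectorCount n₂)) (k : FreqMomentum L M) :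
    klAnisoFamily L M β μ K e₀ n₁ ω₁ k * bgmFatMultiplier L M e₀ β (nambuXiCT L μ K) n₂ ω₂ k =
      ∑ a ∈ (univ : Finset (Fin (sectorCount n₂))).filter (fun a : Fin (sectorCount n₂) =>
          ∃ δ : ℤ, |δ| ≤ 1 ∧ (sectorCount n₂ : ℤ) ∣ (((a : ℕ) : ℤ) - ((ω₂ : ℕ) : ℤ) - δ)),
        klAnisoFamily L M β μ K e₀ n₁ ω₁ k * klAnisoFamily L M β μ K e₀ n₂ a k := by
  set t : ℝ := Real.sqrt (matsubaraFreq β M k.1 ^ 2 + nambuXiCT L μ K k.2 ^ 2) with ht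
  set θ : ℝ := momentumAngle L k.2 with hθ
  -- the angular sum over the `Fin`-indexed neighbour set is the `range`-indexed sum of the definition
  have hsum : ∑ a ∈ (univ : Finset (Fin (sectorCount n₂))).filter (fun a : Fin (sectorCount n₂) =>
        ∃ δ : ℤ, |δ| ≤ 1 ∧ (sectorCount n₂ : ℤ) ∣ (((a : ℕ) : ℤ) - ((ω₂ : ℕ) : ℤ) - δ)),
        sectorWeightCirc n₂ ((a : ℕ) : ℤ) θ =
      ∑ ω' ∈ (range (sectorCount n₂)).filter
        (fun ω' : ℕ => ∃ δ : ℤ, |δ| ≤ 1 ∧ (sectorCount n₂ : ℤ) ∣ ((ω' : ℤ) - ((ω₂ : ℕ) : ℤ) - δ)),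
        sectorWeightCirc n₂ ω' θ := by
    rw [Finset.sum_filter, Finset.sum_filter,
      Fin.sum_univ_eq_sum_range (fun i : ℕ => if (∃ δ : ℤ, |δ| ≤ 1 ∧ (sectorCount n₂ : ℤ) ∣ ((i : ℤ) - ((ω₂ : ℕ) : ℤ) - δ))
        then sectorWeightCirc n₂ (i : ℤ) θ else 0)]
  by_cases hC : gnScaleCutoff 4 e₀ (-(n₁ : ℤ)) t = 0
  · -- off the support of the thin cutoff both sides vanish
    have h1 : klAnisoFamily L M β μ K e₀ n₁ ω₁ k = 0 := by
      unfold klAnisoFamily bgmMultiplier; rw [← ht, hC]; simp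
    rw [h1, zero_mul]
    exact (Finset.sum_eq_zero fun a _ => by rw [zero_mul]).symm
  · -- on the support: `t < e₀ 4^{-n₁}`, so both plateaux are `1`
    have hlt : t < e₀ * (4 : ℝ) ^ (-(n₁ : ℤ)) := lt_of_gnScaleCutoff_ne_zero he hC
    have hmono : (4 : ℝ) ^ (-(n₁ : ℤ)) ≤ (4 : ℝ) ^ (-(n₂ : ℤ) - 1) :=
      zpow_le_zpow_right₀ (by norm_num) (by omega)
    have hle1 : t ≤ e₀ * (4 : ℝ) ^ ((-(n₂ : ℤ) + 1) - 1) := by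
      have : (4 : ℝ) ^ (-(n₁ : ℤ)) ≤ (4 : ℝ) ^ ((-(n₂ : ℤ) + 1) - 1) := zpow_le_zpow_right₀ (by norm_num) (by omega)
      exact hlt.le.trans (mul_le_mul_of_nonneg_left this he.le)
    have hle2 : t ≤ e₀ * (4 : ℝ) ^ (-(n₂ : ℤ) - 1) := hlt.le.trans (mul_le_mul_of_nonneg_left hmono he.le)
    have hfat : gnScaleCutoff 4 e₀ (-(n₂ : ℤ) + 1) t = 1 := gnScaleCutoff_eq_one (by norm_num) he hle1
    have hthin : gnScaleCutoff 4 e₀ (-(n₂ : ℤ)) t = 1 := gnScaleCutoff_eq_one (by norm_num) he hle2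
    have h2 : ∀ a : Fin (sectorCount n₂), klAnisoFamily L M β μ K e₀ n₂ a k = (sectorWeightCirc n₂ ((a : ℕ) : ℤ) θ : ℂ) := by
      intro a
      unfold klAnisoFamily bgmMultiplier
      rw [← ht, hthin, one_mul]
    have hF : bgmFatMultiplier L M e₀ β (nambuXiCT L μ K) n₂ ω₂ k =
        ((∑ a ∈ (univ : Finset (Fin (sectorCount n₂))).filter (fun a : Fin (sectorCount n₂) =>
            ∃ δ : ℤ, |δ| ≤ 1 ∧ (sectorCount n₂ : ℤ) ∣ (((a : ℕ) : ℤ) - ((ω₂ : ℕ) : ℤ) - δ)),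
          sectorWeightCirc n₂ ((a : ℕ) : ℤ) θ : ℝ) : ℂ) := by
      unfold bgmFatMultiplier
      rw [← ht, ← hθ, hfat, one_mul, hsum]
    rw [hF]
    simp_rw [h2]
    rw [Complex.ofReal_sum, Finset.mul_sum]

/-- The `Fin`-indexed neighbour set has at most three elements (`card_fatNbr_le_three` transported along `Fin.val`). [folklore] -/
theorem card_fatNbrFin_le_three (n : ℕ) (ω : ℕ) :
    ((univ : Finset (Fin (sectorCount n))).filter (fun a : Fin (sectorCount n) =>
      ∃ δ : ℤ, |δ| ≤ 1 ∧ (sectorCount n : ℤ) ∣ (((a : ℕ) : ℤ) - (ω : ℤ) - δ))).card ≤ 3 := by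
  calc _ = (((univ : Finset (Fin (sectorCount n))).filter (fun a : Fin (sectorCount n) =>
        ∃ δ : ℤ, |δ| ≤ 1 ∧ (sectorCount n : ℤ) ∣ (((a : ℕ) : ℤ) - (ω : ℤ) - δ))).image (fun a : Fin (sectorCount n) => (a : ℕ))).card :=
        (Finset.card_image_of_injective _ Fin.val_injective).symm
    _ ≤ ((range (sectorCount n)).filter
          (fun ω' : ℕ => ∃ δ : ℤ, |δ| ≤ 1 ∧ (sectorCount n : ℤ) ∣ ((ω' : ℤ) - ((ω : ℕ) : ℤ) - δ))).card := by
        refine Finset.card_le_card fun x hx => ?_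
        rw [Finset.mem_image] at hx
        obtain ⟨a, ha, rfl⟩ := hx
        rw [Finset.mem_filter] at ha ⊢
        exact ⟨Finset.mem_range.2 a.isLt, ha.2⟩
    _ ≤ 3 := card_fatNbr_le_three n ω

/-- The neighbour relation is symmetric: `N ∣ (a − ω − δ)` iff `N ∣ (ω − a − (−δ))`; so the set of `ω` having a given `a` as a
neighbour also has at most three elements. [folklore] -/
theorem card_fatNbrFin_symm_le_three (n : ℕ) (a : ℕ) :
    ((univ : Finset (Fin (sectorCount n))).filter (fun ω : Fin (sectorCount n) =>
      ∃ δ : ℤ, |δ| ≤ 1 ∧ (sectorCount n : ℤ) ∣ ((a : ℤ) - ((ω : ℕ) : ℤ) - δ))).card ≤ 3 := by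
  refine le_trans (Finset.card_le_card fun ω hω => ?_) (card_fatNbrFin_le_three n a)
  rw [Finset.mem_filter] at hω ⊢
  obtain ⟨δ, hδ, hdvd⟩ := hω.2
  refine ⟨hω.1, -δ, by rw [abs_neg]; exact hδ, ?_⟩
  have e : ((ω : ℕ) : ℤ) - (a : ℤ) - (-δ) = -((a : ℤ) - ((ω : ℕ) : ℤ) - δ) := by ring
  rw [e]; exact (dvd_neg).2 hdvd

omit [NeZero L] in
/-- **Support of the fat multiplier, angular part** (every scale `n₂`, band `e`): `F̃_{n₂,ω}(k) ≠ 0 ⇒ ∃ a ∈ S_ω, ζ̃_{n₂,a}(θ(k)) ≠ 0`.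
[cite: BenfattoGiulianiMastropietro2006, §2.7 (2.66)] -/
theorem exists_fatNbr_of_bgmFatMultiplier_ne_zero (e₀ β : ℝ) (e : TorusSite 2 L → ℝ) (n : ℕ) (ω : Fin (sectorCount n))
    (k : FreqMomentum L M) (h : bgmFatMultiplier L M e₀ β e n ω k ≠ 0) :
    ∃ a : Fin (sectorCount n), (∃ δ : ℤ, |δ| ≤ 1 ∧ (sectorCount n : ℤ) ∣ (((a : ℕ) : ℤ) - ((ω : ℕ) : ℤ) - δ)) ∧
      sectorWeightCirc n ((a : ℕ) : ℤ) (momentumAngle L k.2) ≠ 0 := by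
  unfold bgmFatMultiplier at h
  have h' : ∑ ω' ∈ (range (sectorCount n)).filter
      (fun ω' : ℕ => ∃ δ : ℤ, |δ| ≤ 1 ∧ (sectorCount n : ℤ) ∣ ((ω' : ℤ) - ((ω : ℕ) : ℤ) - δ)),
      sectorWeightCirc n ω' (momentumAngle L k.2) ≠ 0 := by
    intro h0; exact h (by rw [h0]; simp)
  obtain ⟨ω', hω', hne⟩ := Finset.exists_ne_zero_of_sum_ne_zero h'
  rw [Finset.mem_filter, Finset.mem_range] at hω'
  exact ⟨⟨ω', hω'.1⟩, hω'.2, hne⟩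

/-! ### §2 The overlap counts of the thin × fat pair -/

/-- **Coarse side**: a thin sector `ω₁` of scale `n₁` meets (common support point) at most `27` fat multipliers of scale `n₂ ≤ n₁` —
`≤ 9` coarse thin sectors (`card_coarse_overlap_le`), each a neighbour of `≤ 3` fat labels. [cite: BenfattoGiulianiMastropietro2006, §2.7 (2.71a)] -/
theorem card_overlap_klAniso_bgmFat_coarse_le {e₀ : ℝ} (he : 0 < e₀) (β μ : ℝ) (K : TrigPolyC4v) {n₁ n₂ : ℕ} (hn : n₂ ≤ n₁)
    (ω₁ : Fin (sectorCount n₁)) :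
    ((univ : Finset (Fin (sectorCount n₂))).filter (fun ω₂ : Fin (sectorCount n₂) =>
      ∃ k : FreqMomentum L M, klAnisoFamily L M β μ K e₀ n₁ ω₁ k ≠ 0 ∧
        bgmFatMultiplier L M e₀ β (nambuXiCT L μ K) n₂ ω₂ k ≠ 0)).card ≤ 27 := by
  -- the coarse thin sectors met by `ω₁`
  set C := (univ : Finset (Fin (sectorCount n₂))).filter (fun a : Fin (sectorCount n₂) =>
      ∃ θ : ℝ, sectorWeightCirc n₁ ((ω₁ : ℕ) : ℤ) θ ≠ 0 ∧ sectorWeightCirc n₂ ((a : ℕ) : ℤ) θ ≠ 0) with hC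
  have hCcard : C.card ≤ 9 := card_coarse_overlap_le hn ω₁
  have hsub : (univ : Finset (Fin (sectorCount n₂))).filter (fun ω₂ : Fin (sectorCount n₂) =>
      ∃ k : FreqMomentum L M, klAnisoFamily L M β μ K e₀ n₁ ω₁ k ≠ 0 ∧
        bgmFatMultiplier L M e₀ β (nambuXiCT L μ K) n₂ ω₂ k ≠ 0) ⊆
      C.biUnion (fun a => (univ : Finset (Fin (sectorCount n₂))).filter (fun ω₂ : Fin (sectorCount n₂) =>
        ∃ δ : ℤ, |δ| ≤ 1 ∧ (sectorCount n₂ : ℤ) ∣ (((a : ℕ) : ℤ) - ((ω₂ : ℕ) : ℤ) - δ))) := by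
    intro ω₂ hω₂
    rw [Finset.mem_filter] at hω₂
    obtain ⟨k, h1, h2⟩ := hω₂.2
    obtain ⟨a, ha, hne⟩ := exists_fatNbr_of_bgmFatMultiplier_ne_zero e₀ β (nambuXiCT L μ K) n₂ ω₂ k h2
    have h1' := (support_klAnisoFamily L M he β μ K n₁ ω₁ k h1).2.2
    rw [Finset.mem_biUnion]
    refine ⟨a, ?_, ?_⟩
    · rw [hC, Finset.mem_filter]; exact ⟨Finset.mem_univ _, momentumAngle L k.2, h1', hne⟩
    · rw [Finset.mem_filter]; exact ⟨Finset.mem_univ _, ha⟩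
  calc _ ≤ (C.biUnion (fun a => (univ : Finset (Fin (sectorCount n₂))).filter (fun ω₂ : Fin (sectorCount n₂) =>
        ∃ δ : ℤ, |δ| ≤ 1 ∧ (sectorCount n₂ : ℤ) ∣ (((a : ℕ) : ℤ) - ((ω₂ : ℕ) : ℤ) - δ)))).card := Finset.card_le_card hsub
    _ ≤ ∑ a ∈ C, ((univ : Finset (Fin (sectorCount n₂))).filter (fun ω₂ : Fin (sectorCount n₂) =>
        ∃ δ : ℤ, |δ| ≤ 1 ∧ (sectorCount n₂ : ℤ) ∣ (((a : ℕ) : ℤ) - ((ω₂ : ℕ) : ℤ) - δ))).card := Finset.card_biUnion_le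
    _ ≤ ∑ _a ∈ C, 3 := Finset.sum_le_sum fun a _ => card_fatNbrFin_symm_le_three n₂ a
    _ = C.card * 3 := by rw [Finset.sum_const, smul_eq_mul]
    _ ≤ 9 * 3 := Nat.mul_le_mul_right 3 hCcard
    _ = 27 := by norm_num

/-- **Fine side**: a fat multiplier `ω₂` of scale `n₂` meets at most `27·2^{n₁−n₂}` thin sectors of scale `n₁ ≥ n₂` — each of its
`≤ 3` neighbours meets `≤ 9·2^{n₁−n₂}` fine sectors (`card_fine_overlap_le`). [cite: BenfattoGiulianiMastropietro2006, §2.7 (2.71a)] -/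
theorem card_overlap_klAniso_bgmFat_fine_le {e₀ : ℝ} (he : 0 < e₀) (β μ : ℝ) (K : TrigPolyC4v) {n₁ n₂ : ℕ} (hn : n₂ ≤ n₁)
    (ω₂ : Fin (sectorCount n₂)) :
    ((univ : Finset (Fin (sectorCount n₁))).filter (fun ω₁ : Fin (sectorCount n₁) =>
      ∃ k : FreqMomentum L M, klAnisoFamily L M β μ K e₀ n₁ ω₁ k ≠ 0 ∧
        bgmFatMultiplier L M e₀ β (nambuXiCT L μ K) n₂ ω₂ k ≠ 0)).card ≤ 27 * 2 ^ (n₁ - n₂) := by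
  set S := (univ : Finset (Fin (sectorCount n₂))).filter (fun a : Fin (sectorCount n₂) =>
      ∃ δ : ℤ, |δ| ≤ 1 ∧ (sectorCount n₂ : ℤ) ∣ (((a : ℕ) : ℤ) - ((ω₂ : ℕ) : ℤ) - δ)) with hS
  have hScard : S.card ≤ 3 := card_fatNbrFin_le_three n₂ (ω₂ : ℕ)
  have hsub : (univ : Finset (Fin (sectorCount n₁))).filter (fun ω₁ : Fin (sectorCount n₁) =>
      ∃ k : FreqMomentum L M, klAnisoFamily L M β μ K e₀ n₁ ω₁ k ≠ 0 ∧
        bgmFatMultiplier L M e₀ β (nambuXiCT L μ K) n₂ ω₂ k ≠ 0) ⊆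
      S.biUnion (fun a => (univ : Finset (Fin (sectorCount n₁))).filter (fun ω₁ : Fin (sectorCount n₁) =>
        ∃ θ : ℝ, sectorWeightCirc n₁ ((ω₁ : ℕ) : ℤ) θ ≠ 0 ∧ sectorWeightCirc n₂ ((a : ℕ) : ℤ) θ ≠ 0)) := by
    intro ω₁ hω₁
    rw [Finset.mem_filter] at hω₁
    obtain ⟨k, h1, h2⟩ := hω₁.2
    obtain ⟨a, ha, hne⟩ := exists_fatNbr_of_bgmFatMultiplier_ne_zero e₀ β (nambuXiCT L μ K) n₂ ω₂ k h2
    have h1' := (support_klAnisoFamily L M he β μ K n₁ ω₁ k h1).2.2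
    rw [Finset.mem_biUnion]
    refine ⟨a, ?_, ?_⟩
    · rw [hS, Finset.mem_filter]; exact ⟨Finset.mem_univ _, ha⟩
    · rw [Finset.mem_filter]; exact ⟨Finset.mem_univ _, momentumAngle L k.2, h1', hne⟩
  calc _ ≤ (S.biUnion (fun a => (univ : Finset (Fin (sectorCount n₁))).filter (fun ω₁ : Fin (sectorCount n₁) =>
        ∃ θ : ℝ, sectorWeightCirc n₁ ((ω₁ : ℕ) : ℤ) θ ≠ 0 ∧ sectorWeightCirc n₂ ((a : ℕ) : ℤ) θ ≠ 0))).card :=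
        Finset.card_le_card hsub
    _ ≤ ∑ a ∈ S, ((univ : Finset (Fin (sectorCount n₁))).filter (fun ω₁ : Fin (sectorCount n₁) =>
        ∃ θ : ℝ, sectorWeightCirc n₁ ((ω₁ : ℕ) : ℤ) θ ≠ 0 ∧ sectorWeightCirc n₂ ((a : ℕ) : ℤ) θ ≠ 0)).card := Finset.card_biUnion_le
    _ ≤ ∑ _a ∈ S, 9 * 2 ^ (n₁ - n₂) := Finset.sum_le_sum fun a _ => card_fine_overlap_le hn a
    _ = S.card * (9 * 2 ^ (n₁ - n₂)) := by rw [Finset.sum_const, smul_eq_mul]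
    _ ≤ 3 * (9 * 2 ^ (n₁ - n₂)) := Nat.mul_le_mul_right _ hScard
    _ = 27 * 2 ^ (n₁ - n₂) := by ring

/-! ### §3 The character sum of the thin × fat symbol and the row/column sums of its overlap kernel -/

variable [NeZero M]

/-- **The `ℓ¹` norm of a space-time character sum is subadditive in the symbol** (finite sums). [folklore] -/
theorem sum_norm_charSum_sum_le {ι : Type*} (s : Finset ι) (G : ι → TorusSite 1 (2 * M) × TorusSite 2 L → ℂ) :
    ∑ z : TorusSite 1 (2 * M) × TorusSite 2 L,
        ‖∑ q : TorusSite 1 (2 * M) × TorusSite 2 L, (torusChar q.1 z.1 * torusChar q.2 z.2) • ∑ i ∈ s, G i q‖ ≤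
      ∑ i ∈ s, ∑ z : TorusSite 1 (2 * M) × TorusSite 2 L,
        ‖∑ q : TorusSite 1 (2 * M) × TorusSite 2 L, (torusChar q.1 z.1 * torusChar q.2 z.2) • G i q‖ := by
  rw [Finset.sum_comm]
  refine Finset.sum_le_sum fun z _ => ?_
  have e : ∑ q : TorusSite 1 (2 * M) × TorusSite 2 L, (torusChar q.1 z.1 * torusChar q.2 z.2) • ∑ i ∈ s, G i q =
      ∑ i ∈ s, ∑ q : TorusSite 1 (2 * M) × TorusSite 2 L, (torusChar q.1 z.1 * torusChar q.2 z.2) • G i q := by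
    simp_rw [Finset.smul_sum]
    rw [Finset.sum_comm]
  rw [e]
  exact norm_sum_le _ _

/-- **The thin × fat character sum is at most three thin × thin character sums**: if for every neighbour `a ∈ S_{ω₂}` the character
sum of `klAniso n₁ ω₁ · klAniso n₂ a` has `ℓ¹` norm `≤ T` (`T ≥ 0`), then the character sum of `klAniso n₁ ω₁ · F̃_{n₂,ω₂}` has `ℓ¹`
norm `≤ 3T` (`n₂ + 1 ≤ n₁`). [cite: BenfattoGiulianiMastropietro2006, §2.7 (2.66), (2.71a)] -/
theorem charSum_klAniso_bgmFat_le {e₀ : ℝ} (he : 0 < e₀) (β μ : ℝ) (K : TrigPolyC4v) {n₁ n₂ : ℕ} (hn : n₂ + 1 ≤ n₁)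
    (ω₁ : Fin (sectorCount n₁)) (ω₂ : Fin (sectorCount n₂)) {T : ℝ} (hT0 : 0 ≤ T)
    (hT : ∀ a : Fin (sectorCount n₂), ∑ z : TorusSite 1 (2 * M) × TorusSite 2 L,
      ‖∑ q : TorusSite 1 (2 * M) × TorusSite 2 L, (torusChar q.1 z.1 * torusChar q.2 z.2) •
        (klAnisoFamily L M β μ K e₀ n₁ ω₁ (⟨(q.1 0).val, ZMod.val_lt (q.1 0)⟩, q.2) *
          klAnisoFamily L M β μ K e₀ n₂ a (⟨(q.1 0).val, ZMod.val_lt (q.1 0)⟩, q.2))‖ ≤ T) :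
    ∑ z : TorusSite 1 (2 * M) × TorusSite 2 L,
      ‖∑ q : TorusSite 1 (2 * M) × TorusSite 2 L, (torusChar q.1 z.1 * torusChar q.2 z.2) •
        (klAnisoFamily L M β μ K e₀ n₁ ω₁ (⟨(q.1 0).val, ZMod.val_lt (q.1 0)⟩, q.2) *
          bgmFatMultiplier L M e₀ β (nambuXiCT L μ K) n₂ ω₂ (⟨(q.1 0).val, ZMod.val_lt (q.1 0)⟩, q.2))‖ ≤ 3 * T := by
  set S := (univ : Finset (Fin (sectorCount n₂))).filter (fun a : Fin (sectorCount n₂) =>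
      ∃ δ : ℤ, |δ| ≤ 1 ∧ (sectorCount n₂ : ℤ) ∣ (((a : ℕ) : ℤ) - ((ω₂ : ℕ) : ℤ) - δ)) with hS
  have hScard : S.card ≤ 3 := card_fatNbrFin_le_three n₂ (ω₂ : ℕ)
  simp_rw [klAnisoFamily_mul_bgmFatMultiplier_eq_sum he β μ K hn ω₁ ω₂]
  refine (sum_norm_charSum_sum_le S (fun a q => klAnisoFamily L M β μ K e₀ n₁ ω₁ (⟨(q.1 0).val, ZMod.val_lt (q.1 0)⟩, q.2) *
    klAnisoFamily L M β μ K e₀ n₂ a (⟨(q.1 0).val, ZMod.val_lt (q.1 0)⟩, q.2))).trans ?_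
  calc _ ≤ ∑ _a ∈ S, T := Finset.sum_le_sum fun a _ => hT a
    _ = S.card * T := by rw [Finset.sum_const, nsmul_eq_mul]
    _ ≤ 3 * T := mul_le_mul_of_nonneg_right (by exact_mod_cast hScard) hT0

/-- **`hrow′` for the thin × fat pair from a uniform thin × thin bound**: if every thin × thin character sum of the scales `(n₁, n₂)`,
`n₂ + 1 ≤ n₁`, has `ℓ¹` norm `≤ T`, then every row sum of the overlap kernel of `(klAnisoFamily … n₁, bgmFatMultiplier … n₂)` is
`≤ 27·(3T/(βL²))`. [cite: BenfattoGiulianiMastropietro2006, §2.7 (2.71a)] -/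
theorem overlap_rowSum_klAniso_bgmFat_le {e₀ β : ℝ} (he : 0 < e₀) (hβ : 0 < β) (μ : ℝ) (K : TrigPolyC4v) {n₁ n₂ : ℕ}
    (hn : n₂ + 1 ≤ n₁) {T : ℝ} (hT0 : 0 ≤ T)
    (hT : ∀ (ω₁ : Fin (sectorCount n₁)) (a : Fin (sectorCount n₂)), ∑ z : TorusSite 1 (2 * M) × TorusSite 2 L,
      ‖∑ q : TorusSite 1 (2 * M) × TorusSite 2 L, (torusChar q.1 z.1 * torusChar q.2 z.2) •
        (klAnisoFamily L M β μ K e₀ n₁ ω₁ (⟨(q.1 0).val, ZMod.val_lt (q.1 0)⟩, q.2) *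
          klAnisoFamily L M β μ K e₀ n₂ a (⟨(q.1 0).val, ZMod.val_lt (q.1 0)⟩, q.2))‖ ≤ T)
    (Y' : SpaceTimeIdx L M × SectorLeg (sectorCount n₁)) :
    ∑ Y, ‖(sectorAnalysisMatrix L M β (klAnisoFamily L M β μ K e₀ n₁) *
        sectorSubMatrix L M β (bgmFatMultiplier L M e₀ β (nambuXiCT L μ K) n₂)) Y' Y‖ ≤ (27 : ℕ) * (3 * T / (β * (L : ℝ) ^ 2)) := by
  have hpair := overlapKernel_sums_le_of_charSum_le hβ (klAnisoFamily L M β μ K e₀ n₁)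
    (bgmFatMultiplier L M e₀ β (nambuXiCT L μ K) n₂) (T := 3 * T)
    (fun ω₁ ω₂ => charSum_klAniso_bgmFat_le he β μ K hn ω₁ ω₂ hT0 (hT ω₁))
  have hL : (0 : ℝ) < L := Nat.cast_pos.2 (Nat.pos_of_ne_zero (NeZero.ne L))
  exact rowSum_sectorAnalysis_mul_sectorSub_le β _ _
    (fun ω₁ => card_overlap_klAniso_bgmFat_coarse_le he β μ K (by omega) ω₁) (by positivity)
    (fun ω' ω σ c y => hpair.1 ω' ω σ c y) Y'

/-- **`hcol′` for the thin × fat pair from a uniform thin × thin bound**: every column sum of the same overlap kernel is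
`≤ 27·2^{n₁−n₂}·(3T/(βL²))`. [cite: BenfattoGiulianiMastropietro2006, §2.7 (2.71a)] -/
theorem overlap_colSum_klAniso_bgmFat_le {e₀ β : ℝ} (he : 0 < e₀) (hβ : 0 < β) (μ : ℝ) (K : TrigPolyC4v) {n₁ n₂ : ℕ}
    (hn : n₂ + 1 ≤ n₁) {T : ℝ} (hT0 : 0 ≤ T)
    (hT : ∀ (ω₁ : Fin (sectorCount n₁)) (a : Fin (sectorCount n₂)), ∑ z : TorusSite 1 (2 * M) × TorusSite 2 L,
      ‖∑ q : TorusSite 1 (2 * M) × TorusSite 2 L, (torusChar q.1 z.1 * torusChar q.2 z.2) •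
        (klAnisoFamily L M β μ K e₀ n₁ ω₁ (⟨(q.1 0).val, ZMod.val_lt (q.1 0)⟩, q.2) *
          klAnisoFamily L M β μ K e₀ n₂ a (⟨(q.1 0).val, ZMod.val_lt (q.1 0)⟩, q.2))‖ ≤ T)
    (Y : SpaceTimeIdx L M × SectorLeg (sectorCount n₂)) :
    ∑ Y', ‖(sectorAnalysisMatrix L M β (klAnisoFamily L M β μ K e₀ n₁) *
        sectorSubMatrix L M β (bgmFatMultiplier L M e₀ β (nambuXiCT L μ K) n₂)) Y' Y‖ ≤
      (27 * 2 ^ (n₁ - n₂) : ℕ) * (3 * T / (β * (L : ℝ) ^ 2)) := by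
  have hpair := overlapKernel_sums_le_of_charSum_le hβ (klAnisoFamily L M β μ K e₀ n₁)
    (bgmFatMultiplier L M e₀ β (nambuXiCT L μ K) n₂) (T := 3 * T)
    (fun ω₁ ω₂ => charSum_klAniso_bgmFat_le he β μ K hn ω₁ ω₂ hT0 (hT ω₁))
  have hL : (0 : ℝ) < L := Nat.cast_pos.2 (Nat.pos_of_ne_zero (NeZero.ne L))
  exact colSum_sectorAnalysis_mul_sectorSub_le β _ _
    (fun ω₂ => card_overlap_klAniso_bgmFat_fine_le he β μ K (by omega) ω₂) (by positivity)
    (fun ω' ω σ c x => hpair.2 ω' ω σ c x) Y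

end Summit.HubbardSuperconductivity.HubbardSuperconductivity.Theorems.TorusFourierL2

end
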